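import Summits.AnomalousDissipation.AnomalousDissipation.Theorems.EnsembleRigidityGPTameDefectFloorParityForm
import HarnessLib

/-!
# Tools for stub `stub_gpParityForm2` of line `Sketch` (crux stmt-AnomalousDissipation-17938, `EnsembleRigidity.GPTameDefectFloor`) — the lattice bookkeeping of the `1/12` enstrophy certificate

Pure lattice arithmetic behind the bound `∫ (v ⊗ v) : ∇f_GP ≥ -(1/12) ‖∇v‖²` on the energy space
(file `…ParityForm2.lean`). On the Fourier side `I(u) = 2π Σⱼ Σₖ Re(conj ûⱼ(k - eⱼ) ûⱼ₊₁(k))`; each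
term ("edge" `(k - eⱼ, k)` of the lattice `ℤ³`, joining shells `|k - eⱼ|²`, `|k|²` of opposite parity)
is bounded by weighted AM–GM `Re(conj a b) ≥ -(α|a|² + β|b|²)/2`, `αβ ≥ 1`, with a weight
`α = W(p, p')` depending on the shells `n = |p|²` of the coefficient and `n' = |p'|²` of its partner:

* `W = n/2` if `n ≥ 3` (partner pays `2/n`), so that a coefficient of shell `n ≥ 3` is charged
  exactly `n ≤ (π/3) n` by its two edges;
* the `24` edges between shell `1` and shell `2` (the top singular block of the strain of `f_GP`)
  get `(13/25, 25/13)`; edges to the (vanishing) zero mode get `(1/2, 2)`.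

The total charge `Σ_p Σ_m C_m(p) |û_m(p)|²` is then compared with the budget `(π/3) Σ_p |p|² ‖û(p)‖²`
(`= (1/12) ‖∇u‖² / π` after the overall factor `π`): pointwise on shells `1` and `≥ 3`
(`form2_shell1`, `form2_shell_ge3`), and on shell `2` after symmetrising `p ↔ -p` (reality of `u`)
and using the divergence-free constraint `p · û(p) = 0`, which on `|p|² = 2` equalises the two
in-plane components (`form2_shell2`; this is where the Leray projection halves the in-plane mass —
the exact treatment of the `1–2` block). `form2_weight_exists` packages the weight with its five
properties, `form2_budget` is the resulting summed inequality for an abstract coefficient family.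
References: FMRT 2001, Ch. IV (the form `b`); Constantin–Foias 1988, Ch. 4 (4.33) (Fourier side of `H`).
-/

-- `Summit.<Summit>.<Problem>` is the tree's mandated summit-side namespace (CONVENTIONS §2); single-conjunct summit, duplicate deliberate.
set_option linter.dupNamespace false

noncomputable section

namespace Summit.AnomalousDissipation.AnomalousDissipation.Theorems.EnsembleRigidity.GPTameDefectFloor

open MeasureTheory Filter Topology UnitAddTorus
open scoped InnerProductSpace RealInnerProductSpace ENNReal NNReal
open Literature.Analysis.FunctionSpaces Literature.Analysis.FluidPDE
open Summit.AnomalousDissipation.AnomalousDissipation.Theorems.EnsembleRigidity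

/-- Local notation: real vector fields on `T³`. -/
local notation "Vec3" => (UnitAddTorus (Fin 3)) → (EuclideanSpace ℝ (Fin 3))
/-- Local notation: `L²(T³; ℝ³)`. -/
local notation "L2" => (Lp (EuclideanSpace ℝ (Fin 3)) 2 (volume : Measure (UnitAddTorus (Fin 3))))
/-- Local notation: the energy space `H`. -/
local notation "H3" => (Torus.energySpace (Fin 3))

/-! ## The lattice `ℤ³`: squared norms of shifted points -/

/-- `|k ± eⱼ|² = |k|² ± 2kⱼ + 1` on `ℤ³`. [folklore] -/
theorem form2_normSq_shift (k : Fin 3 → ℤ) (j : Fin 3) :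
    (∑ i, (k + Pi.single j 1 : Fin 3 → ℤ) i ^ 2) = (∑ i, k i ^ 2) + 2 * k j + 1 ∧
    (∑ i, (k - Pi.single j 1 : Fin 3 → ℤ) i ^ 2) = (∑ i, k i ^ 2) - 2 * k j + 1 := by
  constructor <;> fin_cases j <;> simp [Fin.sum_univ_three] <;> ring

/-- `Torus.freqNormSq k` is the cast of the integer `Σ kᵢ²`. [folklore] -/
theorem form2_cast (k : Fin 3 → ℤ) : ((∑ i, k i ^ 2 : ℤ) : ℝ) = Torus.freqNormSq k := by
  simp [Torus.freqNormSq]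

/-- `Σ kᵢ² = 0` only at the origin. [folklore] -/
theorem form2_eq_zero_of_normSq (k : Fin 3 → ℤ) (h : ∑ i, k i ^ 2 = 0) : k = 0 := by
  have h' : ∀ i ∈ Finset.univ, k i ^ 2 = 0 :=
    (Finset.sum_eq_zero_iff_of_nonneg fun i _ => sq_nonneg (k i)).1 h
  funext i
  exact pow_eq_zero_iff two_ne_zero |>.1 (h' i (Finset.mem_univ i))

/-- Successors in `Fin 3`: `1 + 1 = 2`, `2 + 1 = 0`. [folklore] -/
theorem form2_fin_succ : ((1 : Fin 3) + 1 = 2) ∧ ((2 : Fin 3) + 1 = 0) := ⟨rfl, rfl⟩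

/-! ## Edges: the product of the two weights of an edge is at least one -/

/-- For a weight table `ω(n, n')` with `ω = n/2` on `n ≥ 3`, `ω = 2/n'` on `n < 3 ≤ n'`, and the
values `ω(0,1) = 2`, `ω(1,0) = 1/2`, `ω(1,2) = 13/25`, `ω(2,1) = 25/13`: along every lattice edge
(`n' = n - 2t + 1`, so `n`, `n'` have opposite parity) `ω(n', n) ω(n, n') ≥ 1`. [folklore] -/
theorem form2_edge (ω : ℤ → ℤ → ℝ) (hω3 : ∀ n n', 3 ≤ n → ω n n' = n / 2)
    (hω3' : ∀ n n', n < 3 → 3 ≤ n' → ω n n' = 2 / n') (h01 : ω 0 1 = 2) (h10 : ω 1 0 = 1 / 2)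
    (h12 : ω 1 2 = 13 / 25) (h21 : ω 2 1 = 25 / 13) {n n' t : ℤ} (hn : 0 ≤ n) (hn' : 0 ≤ n')
    (ht : n' = n - 2 * t + 1) : 1 ≤ ω n' n * ω n n' := by
  by_cases h3 : 3 ≤ n <;> by_cases h3' : 3 ≤ n'
  · rw [hω3 _ _ h3', hω3 _ _ h3]
    have a : (3 : ℝ) ≤ n := by exact_mod_cast h3
    have b : (3 : ℝ) ≤ n' := by exact_mod_cast h3'
    nlinarith
  · rw [hω3' _ _ (not_le.1 h3') h3, hω3 _ _ h3]
    have hn0 : (n : ℝ) ≠ 0 := by exact_mod_cast (show n ≠ 0 by omega)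
    rw [div_mul_div_comm, mul_comm (2 : ℝ), div_self (mul_ne_zero hn0 two_ne_zero)]
  · rw [hω3 _ _ h3', hω3' _ _ (not_le.1 h3) h3']
    have hn0 : (n' : ℝ) ≠ 0 := by exact_mod_cast (show n' ≠ 0 by omega)
    rw [div_mul_div_comm, mul_comm (n' : ℝ), div_self (mul_ne_zero two_ne_zero hn0)]
  · rcases (show (n = 0 ∧ n' = 1) ∨ (n = 1 ∧ n' = 0) ∨ (n = 1 ∧ n' = 2) ∨ (n = 2 ∧ n' = 1) by
        omega) with ⟨rfl, rfl⟩ | ⟨rfl, rfl⟩ | ⟨rfl, rfl⟩ | ⟨rfl, rfl⟩ <;>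
      norm_num [h01, h10, h12, h21]

/-! ## Budgets: shells `≥ 3`, shell `1`, and the symmetrised shell `2` -/

/-- Shells `n = |p|² ≥ 3`: both edges of every coefficient carry weight `n/2`, total `n ≤ (π/3) n`.
[folklore] -/
theorem form2_shell_ge3 (ω : ℤ → ℤ → ℝ) (hω3 : ∀ n n', 3 ≤ n → ω n n' = n / 2) (p : Fin 3 → ℤ)
    (h3 : 3 ≤ ∑ i, p i ^ 2) (x : Fin 3 → ℝ) (hx : ∀ i, 0 ≤ x i) :
    ∑ m, (ω (∑ i, p i ^ 2) (∑ i, (p + Pi.single m 1 : Fin 3 → ℤ) i ^ 2) * x m +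
        ω (∑ i, p i ^ 2) (∑ i, (p - Pi.single m 1 : Fin 3 → ℤ) i ^ 2) * x (m + 1)) ≤
      Real.pi / 3 * ((∑ i, p i ^ 2 : ℤ) : ℝ) * ∑ m, x m := by
  have hπ := Real.pi_gt_d2
  have hw : ∀ n', ω (∑ i, p i ^ 2) n' = ((∑ i, p i ^ 2 : ℤ) : ℝ) / 2 := fun n' => hω3 _ _ h3
  simp only [hw]
  have h3' : (3 : ℝ) ≤ ((∑ i, p i ^ 2 : ℤ) : ℝ) := by exact_mod_cast h3
  set n : ℝ := ((∑ i, p i ^ 2 : ℤ) : ℝ)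
  simp only [Fin.sum_univ_three, form2_fin_succ, zero_add]
  have hS : 0 ≤ n * (x 0 + x 1 + x 2) :=
    mul_nonneg (by linarith) (add_nonneg (add_nonneg (hx 0) (hx 1)) (hx 2))
  nlinarith [mul_le_mul_of_nonneg_right (show (1 : ℝ) ≤ Real.pi / 3 by linarith) hS]

/-- Shell `1` (`p = ±eᵢ`): the partners of a shell-`1` coefficient live on the even shells `0, 2, 4`,
where `ω(1, ·) ≤ 13/25`, so each coefficient is charged at most `26/25 ≤ π/3`. [folklore] -/
theorem form2_shell1 (ω : ℤ → ℤ → ℝ) (h1 : ∀ t : ℤ, ω 1 (2 * t) ≤ 13 / 25) (p : Fin 3 → ℤ)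
    (hp : ∑ i, p i ^ 2 = 1) (x : Fin 3 → ℝ) (hx : ∀ i, 0 ≤ x i) :
    ∑ m, (ω (∑ i, p i ^ 2) (∑ i, (p + Pi.single m 1 : Fin 3 → ℤ) i ^ 2) * x m +
        ω (∑ i, p i ^ 2) (∑ i, (p - Pi.single m 1 : Fin 3 → ℤ) i ^ 2) * x (m + 1)) ≤
      Real.pi / 3 * ((∑ i, p i ^ 2 : ℤ) : ℝ) * ∑ m, x m := by
  have hπ := Real.pi_gt_d2
  have key : ∀ m, ω (∑ i, p i ^ 2) (∑ i, (p + Pi.single m 1 : Fin 3 → ℤ) i ^ 2) * x m +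
      ω (∑ i, p i ^ 2) (∑ i, (p - Pi.single m 1 : Fin 3 → ℤ) i ^ 2) * x (m + 1) ≤
      13 / 25 * x m + 13 / 25 * x (m + 1) := by
    intro m
    rw [(form2_normSq_shift p m).1, (form2_normSq_shift p m).2, hp,
      show (1 + 2 * p m + 1 : ℤ) = 2 * (p m + 1) by ring,
      show (1 - 2 * p m + 1 : ℤ) = 2 * (1 - p m) by ring]
    exact add_le_add (mul_le_mul_of_nonneg_right (h1 _) (hx _))
      (mul_le_mul_of_nonneg_right (h1 _) (hx _))
  refine (Finset.sum_le_sum fun m _ => key m).trans ?_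
  rw [hp]
  simp only [Fin.sum_univ_three, form2_fin_succ, zero_add, Int.cast_one]
  nlinarith [hx 0, hx 1, hx 2]

/-- **The symmetrised shell-`2` budget (exact `1–2` block).** For `|p|² = 2` and a transversal
coefficient vector `c ⊥ p` (divergence-free constraint; it forces `|c_a| = |c_b|` for the two
in-plane components), the charges of the slots at `p` and at `-p` (same moduli, by reality)
total at most twice the budget `(π/3)·2·‖c‖²`: with `ω(2,1) = 25/13`, `ω(2,3) = 2/3`, `ω(2,5) = 2/5`
the in-plane pair is charged `1619/195 ≤ 8π/3` per unit and the out-of-plane slot `713/195 ≤ 4π/3`.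
[folklore] -/
theorem form2_shell2 (ω : ℤ → ℤ → ℝ) (h21 : ω 2 1 = 25 / 13) (h23 : ω 2 3 = 2 / 3)
    (h25 : ω 2 5 = 2 / 5) (p : Fin 3 → ℤ) (hp : ∑ i, p i ^ 2 = 2) (c : Fin 3 → ℂ)
    (hc : ∑ i, (p i : ℂ) * c i = 0) :
    ∑ m, (ω 2 (∑ i, (p + Pi.single m 1 : Fin 3 → ℤ) i ^ 2) * ‖c m‖ ^ 2 +
        ω 2 (∑ i, (p - Pi.single m 1 : Fin 3 → ℤ) i ^ 2) * ‖c (m + 1)‖ ^ 2) +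
      ∑ m, (ω 2 (∑ i, (-p + Pi.single m 1 : Fin 3 → ℤ) i ^ 2) * ‖c m‖ ^ 2 +
        ω 2 (∑ i, (-p - Pi.single m 1 : Fin 3 → ℤ) i ^ 2) * ‖c (m + 1)‖ ^ 2) ≤
      2 * (Real.pi / 3 * 2 * ∑ m, ‖c m‖ ^ 2) := by
  have hπ := Real.pi_gt_d2
  simp only [(form2_normSq_shift _ _).1, (form2_normSq_shift _ _).2, Pi.neg_apply,
    Fin.sum_univ_three, form2_fin_succ, zero_add] at hc ⊢
  have hb : ∀ i, -1 ≤ p i ∧ p i ≤ 1 := by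
    intro i
    have h1 : p i ^ 2 ≤ 2 := by
      rw [← hp]
      have := Finset.single_le_sum (f := fun i => p i ^ 2) (fun i _ => sq_nonneg (p i))
        (Finset.mem_univ i)
      simpa [Fin.sum_univ_three] using this
    constructor <;> nlinarith
  simp only [Fin.sum_univ_three] at hp
  obtain ⟨h0, h0'⟩ := hb 0
  obtain ⟨h1, h1'⟩ := hb 1
  obtain ⟨h2, h2'⟩ := hb 2
  have hS := add_nonneg (add_nonneg (sq_nonneg ‖c 0‖) (sq_nonneg ‖c 1‖)) (sq_nonneg ‖c 2‖)
  have hπS := mul_le_mul_of_nonneg_right hπ.le hS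
  interval_cases h : p 0 <;> interval_cases h' : p 1 <;> interval_cases h'' : p 2 <;> norm_num at hp
  all_goals
    norm_num [h21, h23, h25] at hc ⊢
    have hn := congrArg (fun z => ‖z‖ ^ 2) (eq_neg_of_add_eq_zero_left hc)
    simp only [norm_neg] at hn
    nlinarith [hn, hπS]

/-! ## The weight table and the summed budget -/

/-- **The edge weights of the `1/12` certificate.** There is `W : ℤ³ × ℤ³ → [0, ∞)`, `W(p, p')` the
AM–GM weight put on a Fourier coefficient at `p` against its partner at `p'`, with: growth
`W(p, ·) ≤ 2 + |p|²`; `W(k - eⱼ, k) W(k, k - eⱼ) ≥ 1` along every lattice edge; the pointwise budget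
`Σ_m (W(p, p + e_m) |c_m|² + W(p, p - e_m) |c_{m+1}|²) ≤ (π/3) |p|² ‖c‖²` off the shells `0` and `2`;
and on `|p|² = 2`, for transversal `c ⊥ p`, the same for the slots at `p` and `-p` together
(`form2_shell2`). Namely `W(p, p') = ω(|p|², |p'|²)` with `ω(n, ·) = n/2` (`n ≥ 3`),
`ω(n, n') = 2/n'` (`n < 3 ≤ n'`), `ω(·, 0) = 1/2`, `ω(0, ·) = 2`, `ω(1, ·) = 13/25`, `ω(2, ·) = 25/13`
on the remaining small shells. [folklore] -/
theorem form2_weight_exists : ∃ W : (Fin 3 → ℤ) → (Fin 3 → ℤ) → ℝ,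
    (∀ p q, 0 ≤ W p q) ∧
    (∀ p q, W p q ≤ 2 + Torus.freqNormSq p) ∧
    (∀ (k : Fin 3 → ℤ) (j : Fin 3), 1 ≤ W (k - Pi.single j 1) k * W k (k - Pi.single j 1)) ∧
    (∀ p : Fin 3 → ℤ, p ≠ 0 → Torus.freqNormSq p ≠ 2 → ∀ c : Fin 3 → ℂ,
      ∑ m, (W p (p + Pi.single m 1) * ‖c m‖ ^ 2 + W p (p - Pi.single m 1) * ‖c (m + 1)‖ ^ 2) ≤
        Real.pi / 3 * Torus.freqNormSq p * ∑ m, ‖c m‖ ^ 2) ∧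
    (∀ p : Fin 3 → ℤ, Torus.freqNormSq p = 2 → ∀ c : Fin 3 → ℂ, ∑ i, (p i : ℂ) * c i = 0 →
      ∑ m, (W p (p + Pi.single m 1) * ‖c m‖ ^ 2 + W p (p - Pi.single m 1) * ‖c (m + 1)‖ ^ 2) +
        ∑ m, (W (-p) (-p + Pi.single m 1) * ‖c m‖ ^ 2 +
          W (-p) (-p - Pi.single m 1) * ‖c (m + 1)‖ ^ 2) ≤
        2 * (Real.pi / 3 * 2 * ∑ m, ‖c m‖ ^ 2)) := by
  -- the table `ω(n, n')`: weight on a coefficient of shell `n` against a partner of shell `n'`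
  obtain ⟨ω, hω0, hω2, hω3, hω3', h0, h00, h1, h2⟩ : ∃ ω : ℤ → ℤ → ℝ,
      (∀ n n', 0 ≤ n → 0 ≤ ω n n') ∧ (∀ n n', 0 ≤ n → ω n n' ≤ 2 + n) ∧
      (∀ n n', 3 ≤ n → ω n n' = n / 2) ∧ (∀ n n', n < 3 → 3 ≤ n' → ω n n' = 2 / n') ∧
      (∀ n, n < 3 → ω n 0 = 1 / 2) ∧ (∀ n', n' < 3 → n' ≠ 0 → ω 0 n' = 2) ∧
      (∀ n', n' < 3 → n' ≠ 0 → ω 1 n' = 13 / 25) ∧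
      (∀ n', n' < 3 → n' ≠ 0 → ω 2 n' = 25 / 13) := by
    refine ⟨fun n n' => if 3 ≤ n then (n : ℝ) / 2 else if 3 ≤ n' then 2 / (n' : ℝ)
      else if n' = 0 then 1 / 2 else if n = 0 then 2 else if n = 1 then 13 / 25 else 25 / 13,
      fun n n' hn => ?_, fun n n' hn => ?_, fun n n' hn => ?_, fun n n' hn hn' => ?_,
      fun n hn => ?_, fun n' hn' hn'0 => ?_, fun n' hn' hn'0 => ?_, fun n' hn' hn'0 => ?_⟩
    · have hn' : (0 : ℝ) ≤ n := by exact_mod_cast hn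
      dsimp only
      split_ifs with _ hb
      · positivity
      · have hb' : (3 : ℝ) ≤ n' := by exact_mod_cast hb
        positivity
      all_goals norm_num
    · have hn' : (0 : ℝ) ≤ n := by exact_mod_cast hn
      dsimp only
      split_ifs with _ hb
      · linarith
      · have hb' : (3 : ℝ) ≤ n' := by exact_mod_cast hb
        rw [div_le_iff₀ (by linarith)]
        nlinarith
      all_goals linarith
    · dsimp only
      rw [if_pos hn]
    · dsimp only
      rw [if_neg (by omega), if_pos hn']
    · dsimp only
      rw [if_neg (by omega), if_neg (by norm_num), if_pos rfl]
    · dsimp only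
      rw [if_neg (by norm_num), if_neg (by omega), if_neg hn'0, if_pos rfl]
    · dsimp only
      rw [if_neg (by norm_num), if_neg (by omega), if_neg hn'0, if_neg (by norm_num), if_pos rfl]
    · dsimp only
      rw [if_neg (by norm_num), if_neg (by omega), if_neg hn'0, if_neg (by norm_num),
        if_neg (by norm_num)]
  have nn : ∀ p : Fin 3 → ℤ, 0 ≤ ∑ i, p i ^ 2 := fun p => Finset.sum_nonneg fun i _ => sq_nonneg _
  have h23 : ω 2 3 = 2 / 3 := by rw [hω3' 2 3 (by norm_num) (by norm_num)]; norm_num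
  have h25 : ω 2 5 = 2 / 5 := by rw [hω3' 2 5 (by norm_num) (by norm_num)]; norm_num
  have h1' : ∀ t : ℤ, ω 1 (2 * t) ≤ 13 / 25 := by
    intro t
    by_cases ht : 3 ≤ 2 * t
    · rw [hω3' 1 (2 * t) (by norm_num) ht]
      have ht' : (4 : ℝ) ≤ (2 * t : ℤ) := by exact_mod_cast (show (4 : ℤ) ≤ 2 * t by omega)
      rw [div_le_iff₀ (by linarith)]
      nlinarith
    · by_cases ht0 : 2 * t = 0
      · rw [ht0, h0 1 (by norm_num)]
        norm_num
      · rw [h1 (2 * t) (not_le.1 ht) ht0]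
  refine ⟨fun p q => ω (∑ i, p i ^ 2) (∑ i, q i ^ 2), fun p q => hω0 _ _ (nn p), fun p q => ?_,
    fun k j => ?_, fun p hp0 hp2 c => ?_, fun p hp2 c hc => ?_⟩
  · rw [← form2_cast]
    exact hω2 _ _ (nn p)
  · exact form2_edge ω hω3 hω3' (h00 1 (by norm_num) (by norm_num)) (h0 1 (by norm_num))
      (h1 2 (by norm_num) (by norm_num)) (h2 1 (by norm_num) (by norm_num)) (nn k) (nn _)
      (form2_normSq_shift k j).2
  · dsimp only
    have hN2 : (∑ i, p i ^ 2) ≠ 2 := fun h => hp2 (by rw [← form2_cast, h]; norm_num)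
    rw [← form2_cast]
    by_cases h3 : 3 ≤ ∑ i, p i ^ 2
    · exact form2_shell_ge3 ω hω3 p h3 (fun m => ‖c m‖ ^ 2) fun i => sq_nonneg _
    · have hN0 : (∑ i, p i ^ 2) ≠ 0 := fun h => hp0 (form2_eq_zero_of_normSq p h)
      have hN1 : ∑ i, p i ^ 2 = 1 := by have := nn p; omega
      exact form2_shell1 ω h1' p hN1 (fun m => ‖c m‖ ^ 2) fun i => sq_nonneg _
  · dsimp only
    have hN2 : ∑ i, p i ^ 2 = 2 := by exact_mod_cast (form2_cast p).trans hp2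
    have hN2' : ∑ i, (-p) i ^ 2 = 2 := by simpa only [Pi.neg_apply, neg_sq] using hN2
    rw [hN2, hN2']
    exact form2_shell2 ω (h2 1 (by norm_num) (by norm_num)) h23 h25 p hN2 c hc

/-- **The summed budget.** For a coefficient family `c : ℤ³ → ℂ³` with `c(0) = 0`, real
(`|c_m(-p)| = |c_m(p)|`) and transversal (`p · c(p) = 0`), a weight `W` with the two budget
properties of `form2_weight_exists`, and convergent series `G = Σ_p |p|² ‖c(p)‖²`,
`S = Σ_p Σ_m (W(p, p + e_m)|c_m(p)|² + W(p, p - e_m)|c_{m+1}(p)|²)`: `S ≤ (π/3) G`. The defect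
series is symmetrised under `p ↦ -p` and is then termwise nonnegative. [folklore] -/
theorem form2_budget (W : (Fin 3 → ℤ) → (Fin 3 → ℤ) → ℝ)
    (hW4 : ∀ p : Fin 3 → ℤ, p ≠ 0 → Torus.freqNormSq p ≠ 2 → ∀ c : Fin 3 → ℂ,
      ∑ m, (W p (p + Pi.single m 1) * ‖c m‖ ^ 2 + W p (p - Pi.single m 1) * ‖c (m + 1)‖ ^ 2) ≤
        Real.pi / 3 * Torus.freqNormSq p * ∑ m, ‖c m‖ ^ 2)
    (hW5 : ∀ p : Fin 3 → ℤ, Torus.freqNormSq p = 2 → ∀ c : Fin 3 → ℂ, ∑ i, (p i : ℂ) * c i = 0 →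
      ∑ m, (W p (p + Pi.single m 1) * ‖c m‖ ^ 2 + W p (p - Pi.single m 1) * ‖c (m + 1)‖ ^ 2) +
        ∑ m, (W (-p) (-p + Pi.single m 1) * ‖c m‖ ^ 2 +
          W (-p) (-p - Pi.single m 1) * ‖c (m + 1)‖ ^ 2) ≤
        2 * (Real.pi / 3 * 2 * ∑ m, ‖c m‖ ^ 2))
    (c : (Fin 3 → ℤ) → Fin 3 → ℂ) (hc0 : ∀ m, c 0 m = 0) (hneg : ∀ p m, ‖c (-p) m‖ = ‖c p m‖)
    (hdiv : ∀ p : Fin 3 → ℤ, ∑ i, (p i : ℂ) * c p i = 0) {G S : ℝ}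
    (hG : HasSum (fun p => Torus.freqNormSq p * ∑ m, ‖c p m‖ ^ 2) G)
    (hS : HasSum (fun p : Fin 3 → ℤ => ∑ m, (W p (p + Pi.single m 1) * ‖c p m‖ ^ 2 +
      W p (p - Pi.single m 1) * ‖c p (m + 1)‖ ^ 2)) S) :
    S ≤ Real.pi / 3 * G := by
  have hD := (hG.mul_left (Real.pi / 3)).sub hS
  have hDn : HasSum (fun p : Fin 3 → ℤ => Real.pi / 3 * (Torus.freqNormSq (-p) * ∑ m, ‖c (-p) m‖ ^ 2) -
      ∑ m, (W (-p) (-p + Pi.single m 1) * ‖c (-p) m‖ ^ 2 +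
        W (-p) (-p - Pi.single m 1) * ‖c (-p) (m + 1)‖ ^ 2)) (Real.pi / 3 * G - S) := by
    have h0 := (Equiv.neg (Fin 3 → ℤ)).hasSum_iff.2 hD
    simpa only [Function.comp_def, Equiv.neg_apply] using h0
  have key : ∀ p : Fin 3 → ℤ, 0 ≤ Real.pi / 3 * (Torus.freqNormSq p * ∑ m, ‖c p m‖ ^ 2) -
      ∑ m, (W p (p + Pi.single m 1) * ‖c p m‖ ^ 2 + W p (p - Pi.single m 1) * ‖c p (m + 1)‖ ^ 2) +
      (Real.pi / 3 * (Torus.freqNormSq (-p) * ∑ m, ‖c (-p) m‖ ^ 2) -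
      ∑ m, (W (-p) (-p + Pi.single m 1) * ‖c (-p) m‖ ^ 2 +
        W (-p) (-p - Pi.single m 1) * ‖c (-p) (m + 1)‖ ^ 2)) := by
    intro p
    by_cases hp0 : p = 0
    · subst hp0
      simp [hc0]
    have hnn : ∀ m, ‖c (-p) m‖ ^ 2 = ‖c p m‖ ^ 2 := fun m => by rw [hneg]
    have hNn : Torus.freqNormSq (-p) = Torus.freqNormSq p := by simp [Torus.freqNormSq]
    simp only [hnn, hNn]
    by_cases hp2 : Torus.freqNormSq p = 2
    · have h5 := hW5 p hp2 (c p) (hdiv p)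
      rw [hp2]
      linarith
    · have h4 := hW4 p hp0 hp2 (c p)
      have h4' := hW4 (-p) (neg_ne_zero.2 hp0) (by rwa [hNn]) (c p)
      rw [hNn] at h4'
      linarith
  have h := (hD.add hDn).nonneg key
  linarith

/-- **Tools stub `stub_gpParityForm2Tools`**: the weight table of the `1/12` certificate with its
five properties (`form2_weight_exists`) and the summed, symmetrised budget inequality
(`form2_budget`). [folklore] -/
theorem stub_gpParityForm2Tools : (∃ W : (Fin 3 → ℤ) → (Fin 3 → ℤ) → ℝ, (∀ p q, 0 ≤ W p q) ∧ (∀ p q, W p q ≤ 2 + Torus.freqNormSq p) ∧ (∀ (k : Fin 3 → ℤ) (j : Fin 3), 1 ≤ W (k - Pi.single j 1) k * W k (k - Pi.single j 1)) ∧ (∀ p : Fin 3 → ℤ, p ≠ 0 → Torus.freqNormSq p ≠ 2 → ∀ c : Fin 3 → ℂ, ∑ m, (W p (p + Pi.single m 1) * ‖c m‖ ^ 2 + W p (p - Pi.single m 1) * ‖c (m + 1)‖ ^ 2) ≤ Real.pi / 3 * Torus.freqNormSq p * ∑ m, ‖c m‖ ^ 2) ∧ (∀ p : Fin 3 → ℤ,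 Torus.freqNormSq p = 2 → ∀ c : Fin 3 → ℂ, ∑ i, (p i : ℂ) * c i = 0 → ∑ m, (W p (p + Pi.single m 1) * ‖c m‖ ^ 2 + W p (p - Pi.single m 1) * ‖c (m + 1)‖ ^ 2) + ∑ m, (W (-p) (-p + Pi.single m 1) * ‖c m‖ ^ 2 + W (-p) (-p - Pi.single m 1) * ‖c (m + 1)‖ ^ 2) ≤ 2 * (Real.pi / 3 * 2 * ∑ m, ‖c m‖ ^ 2))) ∧ (∀ W : (Fin 3 → ℤ) → (Fin 3 → ℤ) → ℝ, (∀ p : Fin 3 → ℤ, p ≠ 0 → Torus.freqNormSq p ≠ 2 → ∀ c : Fin 3 → ℂ, ∑ m, (W p (p + Pi.single m 1) * ‖c m‖ ^ 2 + W p (p - Pi.single m 1) * ‖c (m + 1)‖ ^ 2) ≤ Real.pi / 3 * Torus.freqNormSq p * ∑ m, ‖c m‖ ^ 2) → (∀ p : Fin 3 → ℤ, Torus.freqNormSq p = 2 → ∀ c : Fin 3 → ℂ, ∑ i, (p i : ℂ) * c i = 0 → ∑ m, (W p (p + Pi.single m 1) * ‖c m‖ ^ 2 + W p (p - Pi.single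 m 1) * ‖c (m + 1)‖ ^ 2) + ∑ m, (W (-p) (-p + Pi.single m 1) * ‖c m‖ ^ 2 + W (-p) (-p - Pi.single m 1) * ‖c (m + 1)‖ ^ 2) ≤ 2 * (Real.pi / 3 * 2 * ∑ m, ‖c m‖ ^ 2)) → ∀ c : (Fin 3 → ℤ) → Fin 3 → ℂ, (∀ m, c 0 m = 0) → (∀ p m, ‖c (-p) m‖ = ‖c p m‖) → (∀ p : Fin 3 → ℤ, ∑ i, (p i : ℂ) * c p i = 0) → ∀ G S : ℝ, HasSum (fun p => Torus.freqNormSq p * ∑ m, ‖c p m‖ ^ 2) G → HasSum (fun p : Fin 3 → ℤ => ∑ m, (W p (p + Pi.single m 1) * ‖c p m‖ ^ 2 + W p (p - Pi.single m 1) * ‖c p (m + 1)‖ ^ 2)) S → S ≤ Real.pi / 3 * G) :=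
  ⟨form2_weight_exists, fun W hW4 hW5 c hc0 hneg hdiv _ _ hG hS =>
    form2_budget W hW4 hW5 c hc0 hneg hdiv hG hS⟩

end Summit.AnomalousDissipation.AnomalousDissipation.Theorems.EnsembleRigidity.GPTameDefectFloor

end
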